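/-
Copyright: public-domain mathematics; typed transcription for the H21 Literature library (cell lit-balaban,
reader/typer seat r02 gen 7 = literature-prover-lit-balaban-r02-g7-0; fold owner of block B2).

statement-level skeleton of published theorems with citation tags; proofs where landed; nothing here is a claim about the Yang–Mills mass gap

# Bałaban, *(Higgs)₂,₃ quantum fields in a finite volume. II. An upper bound*, Commun. Math. Phys. **86** (1982) 555–594
# — (3.11) p. 585 «G′_k ≧ γ₁μ₀²(Lᵏε)²I, G″_k ≧ γ₁m²(Lᵏε)²I», obtained as printed by «us[ing] the mass terms in the fundamental
# operators», FOR THE CONCRETE renormalization-group operators Δ^{(k),Lᵏε}(Ω, Ã) of (2.46)/(3.9) on the (Higgs)₂,₃ tori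

[cite: Balaban1982Higgs2]  T. Bałaban, Commun. Math. Phys. 86 (1982) 555–594.  p. 585 [PDF 31], verbatim (OCR layer of the held scan
`paper:balaban1982-cmp86-higgs23-ii` p0031.txt): «We need the estimates of the quadratic forms in (3.9). Let us denote the quadratic
forms in A_k, φ_k, connected with the first four terms in the exponential under the integral (3.9), by ⟨A_k, G′_kA_k⟩, ⟨φ_k, G″_kφ_k⟩
correspondingly. We will give the estimates from below for these forms. It is sufficient to get very weak estimates because we have the
strong estimates (3.8), (3.10). To get them it suffices to use the mass terms in the fundamental operators −Δ^η + μ₀²(Lᵏε)² and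
−Δ^{η,N}_{Ã^{(k)},B^k(Λ₂^{(k−1)′})} + m²(Lᵏε)². In the next section of this chapter we will formulate a much stronger estimate, which as a
corollary gives  G′_k ≧ γ₁μ₀²(Lᵏε)²I↾_{Λ₅⁽ᵏ⁾},  G″_k ≧ γ₁m²(Lᵏε)²I↾_{Λ₅⁽ᵏ⁾}. (3.11)»  The third and fourth terms of (3.9) are the forms
`−½⟨Λ₅⁽ᵏ⁾A_k, Δ^{(k)}_{Λ₅^{(k−1)}}Λ₅⁽ᵏ⁾A_k⟩ − ½⟨Λ₅⁽ᵏ⁾φ_k, Δ^{(k)}_{Λ₅^{(k−1)}}(B^k(Λ₂^{(k−1)′}), Ã^{(k)})Λ₅⁽ᵏ⁾φ_k⟩` ((2.46) p. 567) of the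
renormalization-group operators of part I [Balaban1982Higgs1] (2.21) p. 610: «⟨ψ, Δ^{(k),Lᵏε}(Ω,A)ψ⟩ = a_k(Lᵏε)^{−2}⟨ψ,ψ⟩ −
a_k²(Lᵏε)^{−4}⟨ψ, Q_k(A)G^ε_k(Ω,A)Q^*_k(A)ψ⟩ (2.21)», «G^ε_k(Ω,A) = (−Δ^{ε,N}_{A,Ω} + m² + a_k(Lᵏε)^{−2}P_k(A))^{−1} (2.20)».

WHAT THIS MODULE ADDS (SKELETON row **B2.Eq3.11** «(3.11)–(3.12)», owner's cell; companion of r02 g3 `B2Ineq311` (the «corollary»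
knitting, schematic), r14 g4 `B2Ineq311MassTerm` (the same bound for `Δ^{(k)}` in PLAIN MATRIX COORDINATES with `QQᵀ = 1`), r02 g7
`B2Ineq312OperatorNorm` ((3.12))).  Here the printed mass-term argument is run ON THE CONCRETE (Higgs)₂,₃ CARRIER — the typer/p35
operators `B1Eq230FluctCov.deltaKA C Ω Ã m² a k` on the tori `HiggsLattice.Site P k` with the weighted scalar products (I.1.5)
`HiggsLattice.siteInner` — for EVERY coupling `C`, region `Ω`, external field `Ã`, every step `1 ≤ k ≤ K`, every volume:
* §1 `siteInner_avgQkLin_self_le` — COVARIANT JENSEN in the (I.1.5) norms, `⟨Q_k(Ã)φ, Q_k(Ã)φ⟩ ≤ ⟨φ, φ⟩` (p23 g9's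
  `B2Ineq329RegularField.cov_jensen_sum` summed over the whole torus);
* §2 **`siteInner_deltaKA_succ_ge`** — the quantitative form of p35's `B1Eq230FluctCovPos.siteInner_deltaKA_succ_pos`:
  `(c·m²/(c + m²))·⟨ψ,ψ⟩ ≤ ⟨ψ, Δ^{(k)}(Ω,Ã)ψ⟩`, `c = a_k(Lᵏε)^{−2}` (`HiggsFluctMeasure.coeff221`), i.e. **(3.11) for the Δ-block with
  γ₁ = a_k/(a_k + m²(Lᵏε)²)** (`gamma1_eq`: `c·m²/(c + m²) = [a_k/(a_k + m²(Lᵏε)²)]·m²` — physical units; the printed `(Lᵏε)²` appears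
  after the rescaling to the unit lattice of p. 584): from (2.21), `X := ⟨Q_k^*ψ, G_kQ_k^*ψ⟩ = ⟨φ,(−Δ^N_Ã)φ⟩ + m²‖φ‖² + c‖Q_kφ‖²`
  (`φ = G_kQ_k^*ψ`) `≥ (m² + c)‖Q_kφ‖²` (the MASS TERM + Jensen) and `X = ⟨ψ, Q_kφ⟩ ≤ ‖ψ‖‖Q_kφ‖`, whence `(m² + c)X ≤ ‖ψ‖²` and
  `⟨ψ,Δ^{(k)}ψ⟩ = c‖ψ‖² − c²X ≥ c·m²/(c + m²)·‖ψ‖²`;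
* §2 `siteInner_deltaKA_succ_ge_uniform` — with r14's `B2Ineq311MassTerm.gamma1_uniform`: ONE constant for all steps and volumes,
  `[a_∞/(a_∞ + m²)]·m²·⟨ψ,ψ⟩ ≤ ⟨ψ, Δ^{(k)}(Ω,Ã)ψ⟩` for `Lᵏε ≤ 1` (`a_∞ = a(1 − L⁻²)`, part I (2.15));
* §3 `siteInner_deltaK_vec_succ_ge(_uniform)` — the VECTOR species (third term of (3.9)): `Δ^{(k)}` at zero charge / whole torus / mass
  `μ₀²` IS the typer's `HiggsFluctMeasure.deltaK` (`B1Eq230FluctCov.deltaKA_zero_field`), so `γ₁μ₀²⟨A,A⟩ ≤ ⟨A, Δ^{(k)}A⟩` likewise.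

HONEST SCOPE.  This is the printed mechanism «use the mass terms in the fundamental operators» for the Δ^{(k)}-blocks of (3.9), on the
concrete objects; the forms `G′_k`, `G″_k` of (3.9) AS WHOLES (the Δ-block restricted to `Λ₅⁽ᵏ⁾` PLUS the averaging squares of the first two
terms, `≥ 0`) are not constructed as concrete objects in the tree — their knitting is r02 g3's schematic `B2Ineq311.ineq311`; the
restriction `↾Λ₅⁽ᵏ⁾` is the evaluation of the form at fields supported in `Λ₅⁽ᵏ⁾` (`siteInner_deltaKA_succ_ge` holds for EVERY `ψ`).
The «much stronger estimate» (Prop. 3.1) road is rows B2.Prop3.1/B2.Eq3.29.  Our γ₁ depends on (a, L) and on m² (resp. μ₀²) through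
`a_∞/(a_∞ + m²)`; print: «γ₁» unspecified beyond (3.11) (Prop. 3.1's γ₀ depends on d and a), with «m² ≦ O(1)» assumed on p. 589.
Theorems only; no definition, no `Prop` fact; nothing of B2 is used as a hypothesis.
-/
import Mathlib
import Literature.MathematicalPhysics.QuantumFieldTheory.Balaban1983to89.B1Eq230FluctCovPos
import Literature.MathematicalPhysics.QuantumFieldTheory.Balaban1983to89.B2Ineq329RegularField
import Literature.MathematicalPhysics.QuantumFieldTheory.Balaban1983to89.B2Ineq311MassTerm

/-! # (3.11) p. 585 for the concrete Δ^{(k),Lᵏε}(Ω, Ã): the mass-term bound with explicit γ₁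

statement-level skeleton of published theorems with citation tags; proofs where landed; nothing here is a claim about the Yang–Mills mass gap -/

open scoped BigOperators InnerProductSpace

namespace Literature.MathematicalPhysics.QuantumFieldTheory.Balaban1983to89.B2Ineq311DeltaKConcrete

open Literature.MathematicalPhysics.QuantumFieldTheory.Balaban1983to89
open HiggsLattice HiggsAveraging HiggsCovariance HiggsCovariancePos HiggsCovarianceCont HiggsFluctMeasure HiggsFluctMeasurePos
  B1Eq230FluctCov B1Eq230FluctCovPos

noncomputable section

variable {P : HiggsLattice.Params} {N : ℕ}

/-! ## §1 Covariant Jensen in the (I.1.5) norms -/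

/-- **Covariant Jensen, (I.1.5)-norm form**: `⟨Q_k(Ã)φ, Q_k(Ã)φ⟩_{T^{(k)}} ≤ ⟨φ, φ⟩_{T^{(0)}}` — the transports are unitary and
`|Bᵏ(y)| = L^{kd}` (p23 g9's `B2Ineq329RegularField.cov_jensen_sum` over the whole torus; `k ≤ K`).  This is the only property of
`Q_k(Ã)` the mass-term argument of p. 585 needs. [cite: Balaban1982Higgs2, (3.11) p.585] [cite: Balaban1982Higgs1, (2.11) p.609] -/
theorem siteInner_avgQkLin_self_le (C : ChargeData N) (A : HiggsLattice.VecField P 0) {k : ℕ} (hk : k ≤ P.K)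
    (φ : ScalarField P 0 N) :
    siteInner (avgQkLin C A k φ) (avgQkLin C A k φ) ≤ siteInner φ φ := by
  have h := B2Ineq329RegularField.cov_jensen_sum C hk A Finset.univ Finset.univ (fun x => by simp) φ
  have hl : siteInner (avgQkLin C A k φ) (avgQkLin C A k φ)
      = ∑ y ∈ Finset.univ, P.mesh k ^ P.d * ‖avgQk C A k φ y‖ ^ 2 := by
    unfold siteInner
    refine Finset.sum_congr rfl fun y _ => ?_
    rw [avgQkLin_apply, real_inner_self_eq_norm_sq]
  have hr : siteInner φ φ = ∑ x ∈ Finset.univ, P.mesh 0 ^ P.d * ‖φ x‖ ^ 2 := by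
    unfold siteInner
    refine Finset.sum_congr rfl fun x _ => ?_
    rw [real_inner_self_eq_norm_sq]
  rw [hl, hr]
  exact h

/-! ## §2 (3.11) for the concrete `Δ^{(k),Lᵏε}(Ω, Ã)`, scalar species -/

section Scalar

variable (C : ChargeData N) (Ω : Finset (HiggsLattice.Site P 0)) (A : HiggsLattice.VecField P 0)

/-- **(3.11) for the Δ-block, concrete, explicit constant** («it suffices to use the mass terms in the fundamental operators»): for
`m² > 0`, `a > 0`, `L > 1`, `1 ≤ k = j+1 ≤ K`, EVERY coupling `C`, region `Ω`, external field `Ã` and EVERY `ψ` on `T^{(k)}`,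
`(c·m²/(c + m²))·⟨ψ,ψ⟩ ≤ ⟨ψ, Δ^{(k),Lᵏε}(Ω,Ã)ψ⟩` with `c = a_k(Lᵏε)^{−2}` — by (I.2.21): `X = ⟨Q_k^*ψ, G_kQ_k^*ψ⟩ =
⟨φ,(−Δ^{ε,N}_{Ã,Ω})φ⟩ + m²‖φ‖² + c‖Q_kφ‖² ≥ (m² + c)‖Q_kφ‖²` (`φ = G_kQ_k^*ψ`; mass term, `−Δ^N ≥ 0`, covariant Jensen) and
`X = ⟨ψ,Q_kφ⟩ ≤ ‖ψ‖‖Q_kφ‖`, so `(m² + c)X ≤ ‖ψ‖²` and `⟨ψ,Δ^{(k)}ψ⟩ = c‖ψ‖² − c²X ≥ c·m²/(c+m²)·‖ψ‖²`.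
[cite: Balaban1982Higgs2, (3.11) p.585] [cite: Balaban1982Higgs1, (2.20)–(2.21) p.610] -/
theorem siteInner_deltaKA_succ_ge {msq a : ℝ} (hmsq : 0 < msq) (ha : 0 < a) (hL : 1 < (P.L : ℝ)) {j : ℕ}
    (hj : j + 1 ≤ P.K) (ψ : ScalarField P (j + 1) N) :
    coeff221 P a (j + 1) * msq / (coeff221 P a (j + 1) + msq) * siteInner ψ ψ
      ≤ siteInner ψ (deltaKA C Ω A msq a (j + 1) ψ) := by
  have hc : 0 < coeff221 P a (j + 1) := coeff221_pos ha hL (Nat.succ_le_succ (Nat.zero_le j))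
  have hak : 0 ≤ B1.aSeq a P.L (j + 1) := (B1.aSeq_pos ha hL (Nat.succ_le_succ (Nat.zero_le j))).le
  set c : ℝ := coeff221 P a (j + 1) with hc_def
  set f : ScalarField P 0 N := avgQkAdj C A (j + 1) ψ with hf_def
  set φ : ScalarField P 0 N := propagatorK C Ω A msq a (j + 1) f with hφ_def
  set s2 : ℝ := siteInner ψ ψ with hs2_def
  set u2 : ℝ := siteInner (avgQkLin C A (j + 1) φ) (avgQkLin C A (j + 1) φ) with hu2_def
  have hs2 : 0 ≤ s2 := siteInner_self_nonneg ψ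
  have hu2 : 0 ≤ u2 := siteInner_self_nonneg _
  -- `(−Δ^{ε,N}_{Ã,Ω} + m² + cP_k(Ã))φ = f`
  have hsolve : covOpK C Ω A msq a (j + 1) φ = f := covOpK_propagatorK_apply C Ω A hmsq a (j + 1) hak f
  -- `X := ⟨f, φ⟩ = ⟨φ, (−Δ^{ε,N}_{Ã,Ω})φ⟩ + m²⟨φ,φ⟩ + c⟨Q_kφ, Q_kφ⟩`
  have hX : siteInner f φ
      = siteInner φ (covLaplacianN C Ω A φ) + msq * siteInner φ φ + c * u2 := by
    have h1 : siteInner f φ = siteInner φ (covOpK C Ω A msq a (j + 1) φ) := by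
      rw [hsolve, siteInner_comm]
    rw [h1, covOpK_eq_coeff221, ← hc_def, LinearMap.add_apply, LinearMap.add_apply, LinearMap.smul_apply,
      LinearMap.smul_apply, LinearMap.id_apply, LinearMap.comp_apply, siteInner_add_right, siteInner_add_right,
      siteInner_smul_right, siteInner_smul_right, siteInner_projPk_eq]
  -- the mass term and Jensen: `X ≥ (m² + c)·u2`
  have hJ : u2 ≤ siteInner φ φ := siteInner_avgQkLin_self_le C A hj φ
  have hXge : (msq + c) * u2 ≤ siteInner f φ := by
    rw [hX]
    have h0 := siteInner_covLaplacianN_nonneg C Ω A φ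
    nlinarith
  -- `X = ⟨ψ, Q_kφ⟩ ≤ ‖ψ‖‖Q_kφ‖`, hence `X² ≤ s2·u2`
  have hadj : siteInner f φ = siteInner ψ (avgQkLin C A (j + 1) φ) := by
    rw [hf_def, siteInner_comm, ← siteInner_avgQkLin, siteInner_comm]
  have hXsq : siteInner f φ ^ 2 ≤ s2 * u2 := by
    rw [hadj]
    have h1 : siteInner ψ (avgQkLin C A (j + 1) φ) ≤ sNorm ψ * sNorm (avgQkLin C A (j + 1) φ) :=
      siteInner_le_sNorm_mul _ _
    have h2 : siteInner (avgQkLin C A (j + 1) φ) ψ ≤ sNorm (avgQkLin C A (j + 1) φ) * sNorm ψ :=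
      siteInner_le_sNorm_mul _ _
    rw [siteInner_comm] at h2
    have hprod : 0 ≤ sNorm ψ * sNorm (avgQkLin C A (j + 1) φ) := mul_nonneg (sNorm_nonneg _) (sNorm_nonneg _)
    have habs : |siteInner ψ (avgQkLin C A (j + 1) φ)| ≤ sNorm ψ * sNorm (avgQkLin C A (j + 1) φ) := by
      rw [abs_le]; constructor <;> nlinarith
    calc siteInner ψ (avgQkLin C A (j + 1) φ) ^ 2
        = |siteInner ψ (avgQkLin C A (j + 1) φ)| ^ 2 := (sq_abs _).symm
      _ ≤ (sNorm ψ * sNorm (avgQkLin C A (j + 1) φ)) ^ 2 := by gcongr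
      _ = s2 * u2 := by rw [mul_pow, sNorm_sq, sNorm_sq]
  -- hence `(m² + c)·X ≤ s2`
  have hX0 : 0 ≤ siteInner f φ := le_trans (mul_nonneg (by positivity) hu2) hXge
  have hkey : (msq + c) * siteInner f φ ≤ s2 := by
    -- `(m²+c)X² ≤ (m²+c)·s2·u2 ≤ s2·X`; divide by `X` when `X > 0`
    rcases hX0.lt_or_eq with hXpos | hX0'
    · have h1 : (msq + c) * siteInner f φ ^ 2 ≤ s2 * siteInner f φ := by
        calc (msq + c) * siteInner f φ ^ 2 ≤ (msq + c) * (s2 * u2) :=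
              mul_le_mul_of_nonneg_left hXsq (by positivity)
          _ = s2 * ((msq + c) * u2) := by ring
          _ ≤ s2 * siteInner f φ := mul_le_mul_of_nonneg_left hXge hs2
      by_contra hnot
      push Not at hnot
      have : s2 * siteInner f φ < (msq + c) * siteInner f φ * siteInner f φ :=
        mul_lt_mul_of_pos_right hnot hXpos
      nlinarith
    · rw [← hX0']; simpa using hs2
  -- (2.21): `⟨ψ, Δ^{(k)}ψ⟩ = c·s2 − c²·X`
  rw [siteInner_deltaKA_succ, ← hc_def, ← hf_def, ← hφ_def, ← hadj, ← hs2_def]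
  have hcm : 0 < c + msq := by positivity
  rw [div_mul_eq_mul_div, div_le_iff₀ hcm]
  nlinarith [mul_pos hc hc, hkey, hX0]

/-- The constant of `siteInner_deltaKA_succ_ge` IS the printed γ₁-shape: `c·m²/(c + m²) = [a_k/(a_k + m²(Lᵏε)²)]·m²` for
`c = a_k(Lᵏε)^{−2}` (`a_k = B1.aSeq a L k`, `Lᵏε = P.mesh k`) — r14's γ₁ of `B2Ineq311MassTerm`. [cite: Balaban1982Higgs2, (3.11) p.585] -/
theorem gamma1_eq (a msq : ℝ) (k : ℕ) :
    coeff221 P a k * msq / (coeff221 P a k + msq)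
      = B1.aSeq a P.L k / (B1.aSeq a P.L k + msq * P.mesh k ^ 2) * msq := by
  have hm : P.mesh k ≠ 0 := (P.mesh_pos k).ne'
  have hm2 : P.mesh k ^ 2 ≠ 0 := pow_ne_zero 2 hm
  rw [coeff221_eq]
  rw [inv_pow]
  field_simp

/-- **(3.11) for the Δ-block with ONE γ₁ for all steps and volumes**: for `m² > 0`, `a > 0`, `1 ≤ k = j+1 ≤ K` with `Lᵏε ≤ 1`,
every `C`, `Ω`, `Ã`, `ψ`: `[a_∞/(a_∞ + m²)]·m²·⟨ψ,ψ⟩ ≤ ⟨ψ, Δ^{(k),Lᵏε}(Ω,Ã)ψ⟩`, `a_∞ = a(1 − L⁻²)` (part I (2.15);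
r14's `B2Ineq311MassTerm.gamma1_uniform`).  The printed «γ₁» reading: independent of k, of the volume, of `Ω` and of `Ã`.
[cite: Balaban1982Higgs2, (3.11) p.585] [cite: Balaban1982Higgs1, (2.15) p.609] -/
theorem siteInner_deltaKA_succ_ge_uniform {msq a : ℝ} (hmsq : 0 < msq) (ha : 0 < a) (hL : 1 < (P.L : ℝ)) {j : ℕ}
    (hj : j + 1 ≤ P.K) (hε : P.mesh (j + 1) ≤ 1) (ψ : ScalarField P (j + 1) N) :
    a * (1 - ((P.L : ℝ) ^ 2)⁻¹) / (a * (1 - ((P.L : ℝ) ^ 2)⁻¹) + msq) * msq * siteInner ψ ψ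
      ≤ siteInner ψ (deltaKA C Ω A msq a (j + 1) ψ) := by
  have h1 := siteInner_deltaKA_succ_ge C Ω A hmsq ha hL hj ψ
  rw [gamma1_eq] at h1
  have hγ := B2Ineq311MassTerm.gamma1_uniform (k := j + 1) (ℓ := P.mesh (j + 1)) ha hL
    (Nat.succ_le_succ (Nat.zero_le j)) hmsq (P.mesh_pos (j + 1)) hε
  have hs2 : 0 ≤ siteInner ψ ψ := siteInner_self_nonneg ψ
  calc a * (1 - ((P.L : ℝ) ^ 2)⁻¹) / (a * (1 - ((P.L : ℝ) ^ 2)⁻¹) + msq) * msq * siteInner ψ ψ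
      ≤ B1.aSeq a P.L (j + 1) / (B1.aSeq a P.L (j + 1) + msq * P.mesh (j + 1) ^ 2) * msq * siteInner ψ ψ := by
        gcongr
    _ ≤ siteInner ψ (deltaKA C Ω A msq a (j + 1) ψ) := h1

end Scalar

/-! ## §3 The vector species (third term of (3.9)): zero charge, whole torus, mass `μ₀²` -/

/-- **(3.11) for the VECTOR-field Δ-block** `⟨A_k, Δ^{(k)}A_k⟩`: the renormalization-group operator of the vector species (part I
p. 608 «N = d and an external vector field A = 0», fundamental operator `−Δ^η + μ₀²(Lᵏε)²`) IS `deltaKA` at zero charge / whole torus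
(`B1Eq230FluctCov.deltaKA_zero_field` = the typer's `HiggsFluctMeasure.deltaK`), so for `μ₀² > 0`, `a > 0`, `L > 1`, `1 ≤ k ≤ K`,
every `B` on `T^{(k)}` (components `Fin P.d`): `(c·μ₀²/(c + μ₀²))·⟨B,B⟩ ≤ ⟨B, Δ^{(k),Lᵏε}B⟩`, `c = a_k(Lᵏε)^{−2}`.
[cite: Balaban1982Higgs2, (3.11) p.585] [cite: Balaban1982Higgs1, (2.21) p.610] -/
theorem siteInner_deltaK_vec_succ_ge {μ0sq a : ℝ} (hμ : 0 < μ0sq) (ha : 0 < a) (hL : 1 < (P.L : ℝ)) {j : ℕ}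
    (hj : j + 1 ≤ P.K) (B : ScalarField P (j + 1) P.d) :
    coeff221 P a (j + 1) * μ0sq / (coeff221 P a (j + 1) + μ0sq) * siteInner B B
      ≤ siteInner B (HiggsFluctMeasure.deltaK P μ0sq a (j + 1) B) := by
  rw [← deltaKA_zero_field]
  exact siteInner_deltaKA_succ_ge _ _ _ hμ ha hL hj B

/-- The vector species with ONE γ₁: `[a_∞/(a_∞ + μ₀²)]·μ₀²·⟨B,B⟩ ≤ ⟨B, Δ^{(k),Lᵏε}B⟩` for `Lᵏε ≤ 1`.
[cite: Balaban1982Higgs2, (3.11) p.585] [cite: Balaban1982Higgs1, (2.15) p.609] -/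
theorem siteInner_deltaK_vec_succ_ge_uniform {μ0sq a : ℝ} (hμ : 0 < μ0sq) (ha : 0 < a) (hL : 1 < (P.L : ℝ)) {j : ℕ}
    (hj : j + 1 ≤ P.K) (hε : P.mesh (j + 1) ≤ 1) (B : ScalarField P (j + 1) P.d) :
    a * (1 - ((P.L : ℝ) ^ 2)⁻¹) / (a * (1 - ((P.L : ℝ) ^ 2)⁻¹) + μ0sq) * μ0sq * siteInner B B
      ≤ siteInner B (HiggsFluctMeasure.deltaK P μ0sq a (j + 1) B) := by
  rw [← deltaKA_zero_field]
  exact siteInner_deltaKA_succ_ge_uniform _ _ _ hμ ha hL hj hε B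

end

end Literature.MathematicalPhysics.QuantumFieldTheory.Balaban1983to89.B2Ineq311DeltaKConcrete
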